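import Summits.BirchSwinnertonDyer.BirchSwinnertonDyer.Theorems.UniversalToricDescentThinCombRatCombTightness
import Summits.BirchSwinnertonDyer.BirchSwinnertonDyer.Theorems.CongruentShaFreeCutUnrSeriesWeierstrass
import Mathlib.RingTheory.PowerSeries.WeierstrassPreparation
import HarnessLib

/-!
# VERTICAL INVISIBILITY: the rational thin comb `ThinCombDvdRat` is blind to EVERY non-zero vertical element
# `h(T₂) ∈ 𝒪⟦T₂⟧` (crux `RationalSplitIMCInclusionAtThree`, stmt-BirchSwinnertonDyer-24207, line `ratwall_thin_comb`;
# helper, `--supports stmt-BirchSwinnertonDyer-24207`; cell `pub/bsd-wall`, LEAD `cruxlead-24207` g25)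

WHY THIS FILE. The registered research stub `stub_ratCombDvdUpTo2` of line `ratwall_thin_comb` (skeleton v8.2,
`Cruxes/RationalSplitIMCInclusionAtThree/Lines/ratwall_thin_comb.lean`) asks for RATIONAL thin-comb divisibility
`ThinCombDvdRat R₀ 3 G L₂`: on comb levels `m` of unbounded order, `3^{t_m}·L₂ ∈ (G, E_m(T₂))` with a per-tooth slack
`3^{t_m}`. The lead census handing that stub back as crux-sized (`LEAD-CENSUS-g16.md` §1 item 3) asserts, in prose,
that «the per-tooth slack `3^t` absorbs exactly the VERTICAL factors `h(T₂)` of `G` … this generalises the tree's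
`T₂`-invisibility `RatCombTightness.ThinCombDvdRat.T₂_mul`». The tree so far certifies this only for the factors
`T₂^k` (`…RatCombTightness`, §1). This file makes the census sentence KERNEL-EXACT in full generality:

* §1 (any commutative `𝒪`) `C_natCast_mem_span_of_eq_X_pow_add`: if `h = X^λ + p·s ∈ 𝒪⟦X⟧` and `λ < deg E_m`
  then `p ∈ (h, E_m)` — because `E_m = X^d + p·w` with `w(0) = 1` (tree `combSeries_eq_X_pow_add`), so
  `E_m − X^{d−λ}·h = p·(w − X^{d−λ}s)` and the bracket is a unit of `𝒪⟦X⟧` as soon as `d > λ`; lifted to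
  `Λ₂(𝒪) = 𝒪⟦T₂⟧⟦T₁⟧` as `const_natCast_mem_span_C_combElt_of_eq_X_pow_add`.
* §2 (any commutative `𝒪`) the MECHANISM `ThinCombDvdRat.mul_of_const_pow_mem`: an element `V ∈ Λ₂(𝒪)` with
  `p^s ∈ (V, E_m(T₂))` on all levels `m ≥ m₀` is INVISIBLE — `ThinCombDvdRat 𝒪 p G F → ThinCombDvdRat 𝒪 p (V·G) F`
  (slack `+s`, levels pushed beyond `m₀`); instances: units (`unit_mul`, slack `0`), constants dividing a power of
  `p` (`const_mul`), and vertical elements of distinguished type `C (X^λ + p·s)` (`C_mul_of_eq_X_pow_add`, slack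
  `+1` on every level `m ≥ λ`, since `deg E_m = φ(p^{m+1}) > m`).
* §3 (`𝒪` a DVR with maximal ideal `(p)`, `(p)`-adically complete — e.g. `ℤ_p`, `R₀ = unrIntegers p`) the HEADLINE
  `ThinCombDvdRat.C_mul_of_ne_zero`: for EVERY non-zero `h ∈ 𝒪⟦T₂⟧`,
  `ThinCombDvdRat 𝒪 p G F → ThinCombDvdRat 𝒪 p (C h · G) F` — by `p`-content extraction `h = p^μ·h₀`
  (`WfDvdMonoid.max_power_factor` for the prime `C p` of the Noetherian domain `𝒪⟦X⟧`) and Mathlib's WEIERSTRASS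
  PREPARATION `h₀ = f·u` (`PowerSeries.isWeierstrassFactorization_weierstrassDistinguished_weierstrassUnit`), `f`
  distinguished `= X^λ + p·s` (`exists_eq_X_pow_add_of_isDistinguishedAt`). Corollary `thinCombDvdRat_C_one_of_ne_zero`:
  `ThinCombDvdRat 𝒪 p (C h) 1` for every `h ≠ 0` — the comb certifies NOTHING about vertical elements; and the
  matching VISIBILITY in `Λ₂` itself, `not_C_dvd_const_pow_of_isDistinguishedAt`: a distinguished vertical `C f` of
  positive degree divides no `p^a` — so every such `(G, F) = (C f, 1)` is a comb-divisible pair with `G ∤ p^a·F`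
  (`not_thinCombDvdRat_rigid_of_isDistinguishedAt`), the general form of the tree's witness `(T₂, 1)`.
* §4 the crux's ring `R₀⟦T₂⟧⟦T₁⟧ = Λ₂(unrIntegers 3)` at `p = 3` (DVR and completeness are tree theorems:
  `…X2.HidaLimitAlgebra.isDiscreteValuationRing_unrIntegers`, `…CongruentShaFreeCutUnrSeriesWeierstrass.isAdicComplete_maximalIdeal`).

READING FOR THE STUB. Write a generator of `Ch_{Λ₂}(X₂)` as `g = g_vert(T₂) · g_hor` with `g_vert ∈ R₀⟦T₂⟧` collecting
the vertical prime factors (`μ`-part `3^μ` included). Then `ThinCombDvdRat R₀ 3 g L₂ ↔ ThinCombDvdRat R₀ 3 g_hor L₂`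
(`→` is monotonicity in `G`, `←` is this file): the research stub is a statement about the NON-VERTICAL part of the
characteristic ideal only; the vertical part (the `𝔭′`-line factors and `μ`) is supplied to the composition by the
symmetry stubs (`RatCombTightness` header, «`T₂`-INVISIBILITY … the symmetry stub supplies what the comb cannot see»).

HONEST FRAMING. Commutative algebra about the SHAPE of one registered stub; nothing here is evidence for or against
the stub, nothing about Beilinson–Flach classes or Selmer groups; BSD is not proved for any curve by any of this.

References: [cite: Washington1997, Lemma 1.4, §7.1 (distinguished polynomials, `Φ_{p^{m+1}}(1) = p`), Thm. 7.3
(Weierstrass preparation)]; [cite: Matsumura1987, Thm. 20.3 (content in Noetherian domains)].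
-/

set_option linter.dupNamespace false
set_option autoImplicit false

noncomputable section

namespace Summit.BirchSwinnertonDyer.BirchSwinnertonDyer.Theorems.UniversalToricDescentThinComb.VerticalInvisibility

open Polynomial
open Literature.NumberTheory.EllipticCurves
open Summit.BirchSwinnertonDyer.BirchSwinnertonDyer.Theorems.UniversalToricDescentThinComb

/-! ## §1 `p ∈ (h, E_m)` for every `h ≡ X^λ (mod p)` with `λ < deg E_m` -/

section Algebra

variable (𝒪 : Type*) [CommRing 𝒪] (p : ℕ) [hp : Fact p.Prime]

/-- **`p ∈ (h, E_m)` in `𝒪⟦X⟧`** for `h = X^λ + p·s` and `λ < d = deg E_m`: with `E_m = X^d + p·w`, `w(0) = 1`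
(tree `combSeries_eq_X_pow_add`), `E_m − X^{d−λ}·h = p·(w − X^{d−λ}·s)` and the bracket has constant term `1`
because `d − λ ≥ 1`, hence is a unit. [cite: Washington1997, Lemma 1.4 and §7.1] -/
theorem C_natCast_mem_span_of_eq_X_pow_add {h s : PowerSeries 𝒪} {l m : ℕ}
    (hh : h = PowerSeries.X ^ l + PowerSeries.C (p : 𝒪) * s) (hl : l < (combPoly p m).natDegree) :
    PowerSeries.C (p : 𝒪) ∈ Ideal.span {h, combSeries 𝒪 p m} := by
  obtain ⟨w, hw1, hw⟩ := combSeries_eq_X_pow_add 𝒪 p m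
  set d := (combPoly p m).natDegree with hd
  have hu : IsUnit (w - PowerSeries.X ^ (d - l) * s) := by
    rw [PowerSeries.isUnit_iff_constantCoeff, map_sub, map_mul, map_pow, PowerSeries.constantCoeff_X,
      zero_pow (Nat.sub_ne_zero_of_lt hl), zero_mul, sub_zero, hw1]
    exact isUnit_one
  obtain ⟨u, hu'⟩ := hu
  have key : PowerSeries.C (p : 𝒪) * (w - PowerSeries.X ^ (d - l) * s) =
      combSeries 𝒪 p m - PowerSeries.X ^ (d - l) * h := by
    have hX : (PowerSeries.X : PowerSeries 𝒪) ^ d = PowerSeries.X ^ (d - l) * PowerSeries.X ^ l := by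
      rw [← pow_add, Nat.sub_add_cancel hl.le]
    rw [hw, hh, hX]
    ring
  rw [Ideal.mem_span_pair]
  refine ⟨-(PowerSeries.X ^ (d - l) : PowerSeries 𝒪) * ((u⁻¹ : (PowerSeries 𝒪)ˣ) : PowerSeries 𝒪),
    ((u⁻¹ : (PowerSeries 𝒪)ˣ) : PowerSeries 𝒪), ?_⟩
  calc -(PowerSeries.X ^ (d - l) : PowerSeries 𝒪) * ((u⁻¹ : (PowerSeries 𝒪)ˣ) : PowerSeries 𝒪) * h +
        ((u⁻¹ : (PowerSeries 𝒪)ˣ) : PowerSeries 𝒪) * combSeries 𝒪 p m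
      = (combSeries 𝒪 p m - PowerSeries.X ^ (d - l) * h) * ((u⁻¹ : (PowerSeries 𝒪)ˣ) : PowerSeries 𝒪) := by ring
    _ = PowerSeries.C (p : 𝒪) * (w - PowerSeries.X ^ (d - l) * s) * ((u⁻¹ : (PowerSeries 𝒪)ˣ) : PowerSeries 𝒪) := by
        rw [key]
    _ = PowerSeries.C (p : 𝒪) := by rw [← hu', mul_assoc, Units.mul_inv, mul_one]

/-- The same in `Λ₂(𝒪) = 𝒪⟦T₂⟧⟦T₁⟧`: **`p ∈ (h(T₂), E_m(T₂))`** for the vertical element `h(T₂) = C h`,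
`h = X^λ + p·s`, `λ < deg E_m`. [cite: Washington1997, Lemma 1.4 and §7.1] -/
theorem const_natCast_mem_span_C_combElt_of_eq_X_pow_add {h s : PowerSeries 𝒪} {l m : ℕ}
    (hh : h = PowerSeries.X ^ l + PowerSeries.C (p : 𝒪) * s) (hl : l < (combPoly p m).natDegree) :
    const 𝒪 (p : 𝒪) ∈ Ideal.span {PowerSeries.C h, combElt 𝒪 p m} := by
  obtain ⟨a, b, hab⟩ := Ideal.mem_span_pair.mp (C_natCast_mem_span_of_eq_X_pow_add 𝒪 p hh hl)
  rw [Ideal.mem_span_pair]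
  refine ⟨PowerSeries.C a, PowerSeries.C b, ?_⟩
  rw [combElt, ← map_mul, ← map_mul, ← map_add, hab]
  rfl

/-! ## §2 The mechanism: `p^s ∈ (V, E_m)` on all large levels makes `V` invisible to the rational comb -/

omit hp in
/-- **MECHANISM.** If `p^s ∈ (V, E_m(T₂))` on every level `m ≥ m₀`, then `V` is INVISIBLE to rational comb
divisibility: `ThinCombDvdRat 𝒪 p G F → ThinCombDvdRat 𝒪 p (V·G) F` (push the level beyond `m₀`, pay slack `+s`:
`p^{s+t}F = (cV + dE_m)(aG + bE_m) ∈ (VG, E_m)`). [cite: Washington1997, §7.1] -/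
theorem ThinCombDvdRat.mul_of_const_pow_mem {V : PowerSeries (PowerSeries 𝒪)} {m₀ s : ℕ}
    (hV : ∀ m : ℕ, m₀ ≤ m → const 𝒪 ((p : 𝒪) ^ s) ∈ Ideal.span {V, combElt 𝒪 p m})
    {G F : PowerSeries (PowerSeries 𝒪)} (h : ThinCombDvdRat 𝒪 p G F) :
    ThinCombDvdRat 𝒪 p (V * G) F := by
  intro n
  obtain ⟨m, hnm, t, hmem⟩ := h (max n m₀)
  refine ⟨m, le_trans (le_max_left _ _) hnm, s + t, ?_⟩
  obtain ⟨a, b, hab⟩ := Ideal.mem_span_pair.mp hmem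
  obtain ⟨c, d, hcd⟩ := Ideal.mem_span_pair.mp (hV m (le_trans (le_max_right _ _) hnm))
  rw [pow_add, map_mul, mul_assoc, ← hab, ← hcd]
  exact Ideal.mem_span_pair.mpr
    ⟨c * a, d * a * G + c * V * b + d * combElt 𝒪 p m * b, by ring⟩

omit hp in
/-- UNITS are invisible (slack `0`): `ThinCombDvdRat 𝒪 p G F → ThinCombDvdRat 𝒪 p (u·G) F`. [cite: Washington1997, §7.1] -/
theorem ThinCombDvdRat.unit_mul {u : PowerSeries (PowerSeries 𝒪)} (hu : IsUnit u)
    {G F : PowerSeries (PowerSeries 𝒪)} (h : ThinCombDvdRat 𝒪 p G F) :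
    ThinCombDvdRat 𝒪 p (u * G) F := by
  obtain ⟨v, rfl⟩ := hu
  refine ThinCombDvdRat.mul_of_const_pow_mem 𝒪 p (m₀ := 0) (s := 0) (fun m _ ↦ ?_) h
  rw [pow_zero, map_one]
  exact Ideal.mem_span_pair.mpr ⟨↑v⁻¹, 0, by rw [Units.inv_mul, zero_mul, add_zero]⟩

omit hp in
/-- CONSTANTS dividing a power of `p` are invisible (slack `+s`): for `c ∣ p^s`,
`ThinCombDvdRat 𝒪 p G F → ThinCombDvdRat 𝒪 p (c·G) F`; in a DVR with uniformiser `p` this is every non-zero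
constant (the `μ`-part). [cite: Washington1997, §7.1] -/
theorem ThinCombDvdRat.const_mul {c : 𝒪} {s : ℕ} (hc : c ∣ (p : 𝒪) ^ s)
    {G F : PowerSeries (PowerSeries 𝒪)} (h : ThinCombDvdRat 𝒪 p G F) :
    ThinCombDvdRat 𝒪 p (const 𝒪 c * G) F := by
  obtain ⟨e, he⟩ := hc
  refine ThinCombDvdRat.mul_of_const_pow_mem 𝒪 p (m₀ := 0) (s := s) (fun m _ ↦ ?_) h
  exact Ideal.mem_span_pair.mpr ⟨const 𝒪 e, 0, by rw [he, map_mul]; ring⟩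

/-- Vertical elements of DISTINGUISHED TYPE are invisible: for `h = X^λ + p·s ∈ 𝒪⟦X⟧`,
`ThinCombDvdRat 𝒪 p G F → ThinCombDvdRat 𝒪 p (h(T₂)·G) F` (slack `+1`, on every level `m ≥ λ`, where
`deg E_m = φ(p^{m+1}) > m ≥ λ`). The case `h = X` (`λ = 1`, `s = 0`) is the tree's `RatCombTightness.ThinCombDvdRat.T₂_mul`.
[cite: Washington1997, Lemma 1.4 and §7.1] -/
theorem ThinCombDvdRat.C_mul_of_eq_X_pow_add {h s : PowerSeries 𝒪} {l : ℕ}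
    (hh : h = PowerSeries.X ^ l + PowerSeries.C (p : 𝒪) * s)
    {G F : PowerSeries (PowerSeries 𝒪)} (hGF : ThinCombDvdRat 𝒪 p G F) :
    ThinCombDvdRat 𝒪 p (PowerSeries.C h * G) F := by
  refine ThinCombDvdRat.mul_of_const_pow_mem 𝒪 p (m₀ := l) (s := 1) (fun m hm ↦ ?_) hGF
  rw [pow_one]
  exact const_natCast_mem_span_C_combElt_of_eq_X_pow_add 𝒪 p hh
    (lt_of_le_of_lt hm (lt_natDegree_combPoly p m))

omit hp in
/-- A DISTINGUISHED polynomial at `(p)` is `X^{deg f} + p·s` as a power series. [cite: Washington1997, §7.1] -/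
theorem exists_eq_X_pow_add_of_isDistinguishedAt {f : 𝒪[X]} (hf : f.IsDistinguishedAt (Ideal.span {(p : 𝒪)})) :
    ∃ s : PowerSeries 𝒪, (f : PowerSeries 𝒪) = PowerSeries.X ^ f.natDegree + PowerSeries.C (p : 𝒪) * s := by
  classical
  have hdvd : ∀ j, j < f.natDegree → (p : 𝒪) ∣ f.coeff j := fun j hj ↦
    Ideal.mem_span_singleton.mp (hf.mem hj)
  choose! c hc using hdvd
  refine ⟨PowerSeries.mk fun j ↦ if j < f.natDegree then c j else 0, ?_⟩
  ext j
  rw [Polynomial.coeff_coe, map_add, PowerSeries.coeff_X_pow, PowerSeries.coeff_C_mul, PowerSeries.coeff_mk]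
  rcases lt_trichotomy j f.natDegree with hlt | heq | hgt
  · rw [if_neg hlt.ne, if_pos hlt, zero_add, hc j hlt]
  · rw [heq, if_pos rfl, if_neg (lt_irrefl _), mul_zero, add_zero]
    exact hf.monic.coeff_natDegree
  · rw [if_neg hgt.ne', if_neg (lt_asymm hgt), mul_zero, add_zero]
    exact Polynomial.coeff_eq_zero_of_natDegree_lt hgt

/-- Hence DISTINGUISHED vertical elements are invisible: `ThinCombDvdRat 𝒪 p G F → ThinCombDvdRat 𝒪 p (f(T₂)·G) F`
for `f ∈ 𝒪[X]` distinguished at `(p)`. [cite: Washington1997, §7.1] -/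
theorem ThinCombDvdRat.C_mul_of_isDistinguishedAt {f : 𝒪[X]} (hf : f.IsDistinguishedAt (Ideal.span {(p : 𝒪)}))
    {G F : PowerSeries (PowerSeries 𝒪)} (hGF : ThinCombDvdRat 𝒪 p G F) :
    ThinCombDvdRat 𝒪 p (PowerSeries.C (f : PowerSeries 𝒪) * G) F := by
  obtain ⟨s, hs⟩ := exists_eq_X_pow_add_of_isDistinguishedAt 𝒪 p hf
  exact ThinCombDvdRat.C_mul_of_eq_X_pow_add 𝒪 p hs hGF

end Algebra

/-! ## §3 Over a complete DVR with maximal ideal `(p)`: EVERY non-zero vertical element is invisible -/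

section Complete

variable (𝒪 : Type*) [CommRing 𝒪] [IsDomain 𝒪] [IsDiscreteValuationRing 𝒪] (p : ℕ) [hp : Fact p.Prime]

omit hp in
/-- `h ∈ 𝒪⟦X⟧` has non-zero reduction modulo the maximal ideal `(p)` iff `p ∤ h` in `𝒪⟦X⟧`.
[cite: Washington1997, §7.1] -/
theorem map_residue_ne_zero_iff_not_C_dvd (hmax : IsLocalRing.maximalIdeal 𝒪 = Ideal.span {(p : 𝒪)})
    (h : PowerSeries 𝒪) : h.map (IsLocalRing.residue 𝒪) ≠ 0 ↔ ¬ PowerSeries.C (p : 𝒪) ∣ h := by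
  constructor
  · rintro hred ⟨q, rfl⟩
    apply hred
    rw [map_mul, PowerSeries.map_C, (IsLocalRing.residue_eq_zero_iff _).mpr
      (hmax ▸ Ideal.mem_span_singleton_self (p : 𝒪)), map_zero, zero_mul]
  · intro hndvd h0
    apply hndvd
    have hcoef : ∀ n, (p : 𝒪) ∣ PowerSeries.coeff n h := fun n ↦ by
      have := congrArg (PowerSeries.coeff n) h0
      rw [PowerSeries.coeff_map, map_zero, IsLocalRing.residue_eq_zero_iff, hmax] at this
      exact Ideal.mem_span_singleton.mp this
    choose b hb using hcoef
    exact ⟨PowerSeries.mk b, by ext n; rw [PowerSeries.coeff_C_mul, PowerSeries.coeff_mk, hb n]⟩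

/-- Vertical elements of NON-ZERO REDUCTION are invisible over a `(p)`-adically complete DVR: Weierstrass preparation
`h = f·u` (Mathlib `PowerSeries.isWeierstrassFactorization_weierstrassDistinguished_weierstrassUnit`), `f` distinguished,
`u` a unit. [cite: Washington1997, Thm. 7.3 (Weierstrass preparation) and §7.1] -/
theorem ThinCombDvdRat.C_mul_of_map_residue_ne_zero [IsAdicComplete (IsLocalRing.maximalIdeal 𝒪) 𝒪]
    (hmax : IsLocalRing.maximalIdeal 𝒪 = Ideal.span {(p : 𝒪)}) {h : PowerSeries 𝒪}
    (hred : h.map (IsLocalRing.residue 𝒪) ≠ 0)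
    {G F : PowerSeries (PowerSeries 𝒪)} (hGF : ThinCombDvdRat 𝒪 p G F) :
    ThinCombDvdRat 𝒪 p (PowerSeries.C h * G) F := by
  obtain ⟨f, u, H⟩ := h.exists_isWeierstrassFactorization hred
  have hf : f.IsDistinguishedAt (Ideal.span {(p : 𝒪)}) := hmax ▸ H.isDistinguishedAt
  rw [H.eq_mul, map_mul, mul_comm (PowerSeries.C (f : PowerSeries 𝒪)) (PowerSeries.C u), mul_assoc]
  exact ThinCombDvdRat.unit_mul 𝒪 p (H.isUnit.map _) (ThinCombDvdRat.C_mul_of_isDistinguishedAt 𝒪 p hf hGF)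

/-- **VERTICAL INVISIBILITY (headline).** Over a `(p)`-adically complete DVR `𝒪` with maximal ideal `(p)`, EVERY
non-zero vertical element `h(T₂)`, `h ∈ 𝒪⟦X⟧`, is invisible to rational comb divisibility:
`ThinCombDvdRat 𝒪 p G F → ThinCombDvdRat 𝒪 p (h(T₂)·G) F`. Proof: `p`-content `h = p^μ·h₀` with `p ∤ h₀`
(`WfDvdMonoid.max_power_factor` for the prime `C p` of the Noetherian domain `𝒪⟦X⟧`), then `const_mul` (slack `+μ`)
and `C_mul_of_map_residue_ne_zero` (slack `+1`). So the per-tooth slack of the rational comb absorbs exactly the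
`μ`-part and all vertical (= `T₂`-only) factors of `G`. [cite: Washington1997, Thm. 7.3 and §7.1] -/
theorem ThinCombDvdRat.C_mul_of_ne_zero [IsAdicComplete (IsLocalRing.maximalIdeal 𝒪) 𝒪]
    (hmax : IsLocalRing.maximalIdeal 𝒪 = Ideal.span {(p : 𝒪)}) {h : PowerSeries 𝒪} (hne : h ≠ 0)
    {G F : PowerSeries (PowerSeries 𝒪)} (hGF : ThinCombDvdRat 𝒪 p G F) :
    ThinCombDvdRat 𝒪 p (PowerSeries.C h * G) F := by
  obtain ⟨-, -, -, hpprime⟩ := p_ne_zero_of_maximalIdeal_eq 𝒪 p hmax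
  have hCirr : Irreducible (PowerSeries.C (p : 𝒪)) := (prime_C_of_prime hpprime).irreducible
  obtain ⟨μ, h₀, hndvd, rfl⟩ := WfDvdMonoid.max_power_factor hne hCirr
  have hred : h₀.map (IsLocalRing.residue 𝒪) ≠ 0 := (map_residue_ne_zero_iff_not_C_dvd 𝒪 p hmax h₀).mpr hndvd
  have heq : PowerSeries.C (PowerSeries.C (p : 𝒪) ^ μ * h₀) * G =
      const 𝒪 ((p : 𝒪) ^ μ) * (PowerSeries.C h₀ * G) := by
    rw [map_mul, map_pow, map_pow, mul_assoc]
    rfl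
  rw [heq]
  exact ThinCombDvdRat.const_mul 𝒪 p (dvd_refl _) (ThinCombDvdRat.C_mul_of_map_residue_ne_zero 𝒪 p hmax hred hGF)

/-- **THE COMB CERTIFIES NOTHING VERTICAL**: `ThinCombDvdRat 𝒪 p (h(T₂)) 1` for EVERY non-zero `h ∈ 𝒪⟦X⟧`.
[cite: Washington1997, Thm. 7.3 and §7.1] -/
theorem thinCombDvdRat_C_one_of_ne_zero [IsAdicComplete (IsLocalRing.maximalIdeal 𝒪) 𝒪]
    (hmax : IsLocalRing.maximalIdeal 𝒪 = Ideal.span {(p : 𝒪)}) {h : PowerSeries 𝒪} (hne : h ≠ 0) :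
    ThinCombDvdRat 𝒪 p (PowerSeries.C h) 1 := by
  simpa only [mul_one] using
    ThinCombDvdRat.C_mul_of_ne_zero 𝒪 p hmax hne (RatCombTightness.thinCombDvdRat_of_dvd 𝒪 p (dvd_refl (1 : PowerSeries (PowerSeries 𝒪))))

omit [IsDiscreteValuationRing 𝒪] hp in
/-- In `𝒪⟦X⟧` over a domain with `p ≠ 0` a non-unit: an element `f = X^λ + p·s` with `λ ≥ 1` divides no `p^a`
(descent on `a`: from `f·q = p^{a+1}` read `X^λ·q = p·(p^a − s·q)`, so every coefficient of `q` is divisible by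
`p` and `f·(q/p) = p^a`; at `a = 0`, `f(0) = p·s(0)` would be a unit). [cite: Washington1997, §7.1] -/
theorem not_dvd_C_pow_of_eq_X_pow_add (hp0 : (p : 𝒪) ≠ 0) (hpu : ¬ IsUnit (p : 𝒪)) {f s : PowerSeries 𝒪}
    {l : ℕ} (hs : f = PowerSeries.X ^ l + PowerSeries.C (p : 𝒪) * s) (hl : 0 < l) :
    ∀ a : ℕ, ¬ f ∣ PowerSeries.C ((p : 𝒪) ^ a) := by
  -- `f(0) = p·s(0)` is not a unit
  have hf0 : ¬ IsUnit f := by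
    intro hu
    have h0 := PowerSeries.isUnit_constantCoeff _ hu
    rw [hs, map_add, map_pow, PowerSeries.constantCoeff_X, zero_pow hl.ne', zero_add, map_mul,
      PowerSeries.constantCoeff_C] at h0
    exact hpu (isUnit_of_mul_isUnit_left h0)
  intro a
  induction a with
  | zero =>
    rintro ⟨q, hq⟩
    rw [pow_zero, map_one] at hq
    exact hf0 (IsUnit.of_mul_eq_one q hq.symm)
  | succ a ih =>
    rintro ⟨q, hq⟩
    -- `X^λ · q = p · (p^a − s·q)`
    have hXq : PowerSeries.X ^ l * q = PowerSeries.C (p : 𝒪) * (PowerSeries.C (p : 𝒪) ^ a - s * q) := by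
      have h1 : f * q = PowerSeries.C (p : 𝒪) ^ (a + 1) := by rw [← map_pow]; exact hq.symm
      rw [hs] at h1
      linear_combination h1
    -- hence every coefficient of `q` is divisible by `p`
    have hcoef : ∀ n, (p : 𝒪) ∣ PowerSeries.coeff n q := by
      intro n
      have h2 := PowerSeries.coeff_X_pow_mul q l n
      rw [hXq, PowerSeries.coeff_C_mul] at h2
      exact ⟨_, h2.symm⟩
    choose b hb using hcoef
    apply ih
    refine ⟨PowerSeries.mk b, ?_⟩
    have hq' : q = PowerSeries.C (p : 𝒪) * PowerSeries.mk b := by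
      ext n; rw [PowerSeries.coeff_C_mul, PowerSeries.coeff_mk, hb n]
    have h3 : PowerSeries.C (p : 𝒪) * (PowerSeries.C ((p : 𝒪) ^ a) - f * PowerSeries.mk b) = 0 := by
      rw [mul_sub, ← map_mul, ← pow_succ', hq, hq']; ring
    exact sub_eq_zero.mp (C_mul_eq_zero_imp (fun z hz ↦ (mul_eq_zero.mp hz).resolve_left hp0) h3)

omit hp in
/-- … while `Λ₂(𝒪)` itself SEES them: a DISTINGUISHED vertical `f(T₂)` of positive degree divides no `p^a` in
`Λ₂(𝒪)` (read the `T₁`-constant term and apply `not_dvd_C_pow_of_eq_X_pow_add`). [cite: Washington1997, §7.1] -/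
theorem not_C_dvd_const_pow_of_isDistinguishedAt (hmax : IsLocalRing.maximalIdeal 𝒪 = Ideal.span {(p : 𝒪)})
    {f : 𝒪[X]} (hf : f.IsDistinguishedAt (Ideal.span {(p : 𝒪)})) (hdeg : 0 < f.natDegree) (a : ℕ) :
    ¬ PowerSeries.C (f : PowerSeries 𝒪) ∣ const 𝒪 ((p : 𝒪) ^ a) := by
  obtain ⟨hp0, hpu, -, -⟩ := p_ne_zero_of_maximalIdeal_eq 𝒪 p hmax
  obtain ⟨s, hs⟩ := exists_eq_X_pow_add_of_isDistinguishedAt 𝒪 p hf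
  rintro ⟨q, hq⟩
  apply not_dvd_C_pow_of_eq_X_pow_add 𝒪 p hp0 hpu hs hdeg a
  refine ⟨PowerSeries.constantCoeff q, ?_⟩
  have := congrArg PowerSeries.constantCoeff hq
  rwa [map_mul, PowerSeries.constantCoeff_C, const, RingHom.comp_apply, PowerSeries.constantCoeff_C] at this

/-- **Invisible on the comb, visible in `Λ₂`**: for every DISTINGUISHED vertical `f(T₂)` of positive degree the pair
`(G, F) = (f(T₂), 1)` is comb-divisible with slack (`ThinCombDvdRat 𝒪 p (f(T₂)) 1`) although `f(T₂) ∤ p^a·1` for every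
`a` — the general form of the tree's witness `(T₂, 1)` (`RatCombTightness.not_thinCombDvdRat_rigid`): rational comb
divisibility ALONE recovers no vertical factor of `G`. [cite: Washington1997, §7.1] -/
theorem not_thinCombDvdRat_rigid_of_isDistinguishedAt (hmax : IsLocalRing.maximalIdeal 𝒪 = Ideal.span {(p : 𝒪)})
    {f : 𝒪[X]} (hf : f.IsDistinguishedAt (Ideal.span {(p : 𝒪)})) (hdeg : 0 < f.natDegree) :
    ThinCombDvdRat 𝒪 p (PowerSeries.C (f : PowerSeries 𝒪)) 1 ∧
      ∀ a : ℕ, ¬ PowerSeries.C (f : PowerSeries 𝒪) ∣ const 𝒪 ((p : 𝒪) ^ a) * 1 := by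
  refine ⟨?_, fun a ↦ by rw [mul_one]; exact not_C_dvd_const_pow_of_isDistinguishedAt 𝒪 p hmax hf hdeg a⟩
  simpa only [mul_one] using
    ThinCombDvdRat.C_mul_of_isDistinguishedAt 𝒪 p hf (RatCombTightness.thinCombDvdRat_of_dvd 𝒪 p (dvd_refl (1 : PowerSeries (PowerSeries 𝒪))))

end Complete

/-! ## §4 The crux's ring `R₀⟦T₂⟧⟦T₁⟧ = Λ₂(unrIntegers 3)` at `p = 3` -/

section Unr

open Summit.BirchSwinnertonDyer.Rank1Residual.X2.HidaLimitAlgebra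

/-- **In the crux's ring every non-zero vertical element is invisible to the rational `3`-comb**: for all non-zero
`h ∈ R₀⟦X⟧`, `R₀ = unrIntegers 3`, `ThinCombDvdRat R₀ 3 G F → ThinCombDvdRat R₀ 3 (h(T₂)·G) F` — the registered stub
`stub_ratCombDvdUpTo2` (`ThinCombDvdRat R₀ 3 g L₂`, `(g) = Ch_{Λ₂}(X₂)`) constrains only the non-vertical part of `g`.
(`R₀` is a DVR with uniformiser `3`, `(3)`-adically complete: tree theorems.) [cite: Washington1997, Thm. 7.3 and §7.1] -/
theorem ThinCombDvdRat.C_mul_of_ne_zero_unr {h : PowerSeries (unrIntegers 3)} (hne : h ≠ 0)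
    {G F : PowerSeries (PowerSeries (unrIntegers 3))} (hGF : ThinCombDvdRat (unrIntegers 3) 3 G F) :
    ThinCombDvdRat (unrIntegers 3) 3 (PowerSeries.C h * G) F := by
  haveI := isDiscreteValuationRing_unrIntegers (p := 3)
  haveI := Summit.BirchSwinnertonDyer.BirchSwinnertonDyer.Theorems.CongruentShaFreeCutUnrSeriesWeierstrass.isAdicComplete_maximalIdeal
    (p := 3)
  have hmax : IsLocalRing.maximalIdeal (unrIntegers 3) = Ideal.span {((3 : ℕ) : unrIntegers 3)} :=
    (IsDiscreteValuationRing.irreducible_iff_uniformizer _).mp irreducible_natCast_p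
  exact ThinCombDvdRat.C_mul_of_ne_zero (unrIntegers 3) 3 hmax hne hGF

/-- **In the crux's ring the rational `3`-comb certifies nothing vertical**: `ThinCombDvdRat R₀ 3 (h(T₂)) 1` for every
non-zero `h ∈ R₀⟦X⟧`. [cite: Washington1997, Thm. 7.3 and §7.1] -/
theorem thinCombDvdRat_C_one_of_ne_zero_unr {h : PowerSeries (unrIntegers 3)} (hne : h ≠ 0) :
    ThinCombDvdRat (unrIntegers 3) 3 (PowerSeries.C h) 1 := by
  simpa only [mul_one] using
    ThinCombDvdRat.C_mul_of_ne_zero_unr hne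
      (RatCombTightness.thinCombDvdRat_of_dvd (unrIntegers 3) 3 (dvd_refl (1 : PowerSeries (PowerSeries (unrIntegers 3)))))

end Unr

end Summit.BirchSwinnertonDyer.BirchSwinnertonDyer.Theorems.UniversalToricDescentThinComb.VerticalInvisibility

end
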